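import Summits.Ventures.LatticeQCDFlow.Exactness.Phi4FlowSquareIntegrableAcceptanceCeiling
import Summits.Ventures.LatticeQCDFlow.Exactness.Phi4FlowSquareIntegrableSticking
import Summits.Ventures.LatticeQCDFlow.Exactness.ReversibleVariationalCeilingTermwise
import Summits.Ventures.LatticeQCDFlow.Exactness.Phi4FlowSymmetricMagnetisationExact
import HarnessLib

/-!
# ONE COLUMN BRACKETS `τ_int`: `½ + S ≤ τ_int(g) ≤ (1 + S)/ā − ½` with `S = E_{g²}[r/(1 − r)]` the mean sticking odds — for every square-integrable observable of the exact flow sampler, the magnetisation of lattice φ⁴ included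

HONEST FRAMING: exact (Metropolis-corrected) sampling algorithms for lattice gauge theory;
figures of merit are autocorrelation/cost numbers at stated couplings and volumes; no
continuum-physics claim.  (SCALAR calibration rung S0-A: not a gauge result.)

Venture `LatticeQCDFlow` (cell pub-lqcd), topic `Exactness`; FANOUT row 2 (`s0-phi4`, FLOW arm:
independence Metropolis `K = imhOp μ w q̃`; lattice `imhOpPhi4 J λ q̃`).  NEW WORK of the cell,
composing two GEN-21 files: the acceptance-weighted CEILING `τ_int(g) ≤ E_{g²}[1/ρ]/ā − ½`
(`FlowSamplerSquareIntegrableAcceptanceCeiling`, Deligiannidis–Lee shape, NAMED there) and the summed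
sticking FLOOR `τ_int(g) ≥ ½ + E_{g²}[r/(1 − r)]` (`Phi4FlowSquareIntegrableSticking`, via the
all-lag floors of `FlowSamplerSquareIntegrableSticking`).  The observation of this file: the two
columns are ONE column — pointwise `1/ρ = 1 + r/(1 − r)` (`ρ = 1 − r` the per-configuration
acceptance) — so a single equilibrium average `S_g = E_{g²w}[r/(1 − r)]/E[g²w]` (the `g²`-weighted
mean number of consecutive rejections) and the acceptance rate `ā` bracket `τ_int(g)` from both
sides, with NO summability hypothesis (the ceiling supplies it).  Nothing is cited as a fact.

## What is proved

General space (`(X, μ)` s-finite; `w, q > 0` measurable integrable, `∫ q = 1`, `Z = ∫ w`;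
`r(x) = ∫ (1 − α(x,z)) q(z)`, `ρ = 1 − r`, `ā = ∫ ρ w / Z`; `g` measurable, `∫ g² w < ∞`, `∫ g w = 0`,
`P = ∫ g² w > 0`, `G₂ = ∫ g² w/ρ < ∞`):
* `integral_sq_mul_weight_div_acc_eq_of_sq` — `g² w r/(1 − r) ∈ L¹` and `G₂ = P + ∫ g² w r/(1 − r)`;
* **`imhOp_tauInt_bracket_of_sq`** — the normalised autocorrelation series of `g` IS SUMMABLE and
  **`½ + S_g ≤ τ_int(g) ≤ (1 + S_g)/ā − ½`**, `S_g = (∫ g² w r/(1 − r))/P`;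
* **`imhOp_autocorr_le_div_of_sq`** — lag by lag, **`ρ_g(N) ≤ ((1 + S_g)/ā)/(N + 1)`** (positive
  operator: nonincreasing autocovariances with capped partial sums, `ReversibleVariationalCeilingTermwise`).

Lattice (`Λ = Fin (n+1)`, every `λ > 0`, real `J`, positive measurable model density, `∫ q̃ = 1`):
* **`phi4Flow_tauInt_bracket_poly`** — every `f ∈ PolyObs` with `Var f > 0` and `G₂ < ∞`;
* **`phi4Flow_tauInt_bracket_magnetisation`** — the magnetisation `M` (`Var M > 0` from the tree);
* **`phi4Flow_tauInt_bracket_magnetisation_of_gaussian_minorant`** — `G₂(M) < ∞` DISCHARGED from a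
  Gaussian minorant `q̃ ≥ c e^{−κΣφ²}` of the model density: the bracket for `M` unconditionally in
  the network class of `Phi4FlowSamplerGaussianMinorant` (affine couplings, bounded log-scales);
* **`phi4Flow_autocorr_le_div_magnetisation`** — `ρ_M(N) ≤ ((1 + S_M)/ā)/(N + 1)` at every lag;
* **`phi4Flow_tauInt_magnetisation_eq_of_gaussian_minorant`** — for a `Z₂`-SYMMETRIC flow
  (`q̃(−φ) = q̃(φ)`) with a Gaussian minorant the lower end is ATTAINED with a finite column:
  `τ_int(M) = ½ + S_M` exactly (`Phi4FlowSymmetricMagnetisationExact`).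

Reading for S0-A (no numerics implied): the bracket is exact at `q̃ = π` (`r ≡ 0`, `ā = 1`,
`τ_int = ½`) and its two sides differ by the factor `1/ā` up to `O(1)`: for the flow arm the
integrated autocorrelation time of the magnetisation IS, up to the acceptance rate, the
`M̃²`-weighted mean number of consecutive rejections.  On the toy check of HOME/s0-phi4/analysis-gen21
(finite-state samplers) the ceiling is attained to within 3 %.
NOT CLAIMED: any value of `S`, `ā`, `G₂` for any run or trained network; anything for the HMC /
local arms (no such bracket: `Phi4HMCNoSpectralGap`).
-/

namespace Summit.Ventures.LatticeQCDFlow.Exactness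

open Real MeasureTheory Filter Finset Set
open Summit.Ventures.LatticeQCDFlow.Scoring

/-! ## §1 General space -/

section General

variable {X : Type*} [MeasurableSpace X] {μ : Measure X} [SFinite μ] {w q : X → ℝ}

/-- **ONE COLUMN**: `1/ρ = 1 + r/(1 − r)` integrated against `g² w` — if `G₂ = ∫ g² w/ρ < ∞` then
`g² w · r/(1 − r) ∈ L¹` and `G₂ = ∫ g² w + ∫ g² w r/(1 − r)`. -/
theorem integral_sq_mul_weight_div_acc_eq_of_sq (hw0 : ∀ t, 0 < w t) (hwm : Measurable w)
    (hwi : Integrable w μ) (hq0 : ∀ t, 0 < q t) (hqm : Measurable q) (hqi : Integrable q μ)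
    (hq1 : ∫ z, q z ∂μ = 1) {g : X → ℝ} (hg2 : Integrable (fun t => g t ^ 2 * w t) μ)
    (hG : Integrable (fun t => g t ^ 2 * w t / (1 - rejCurve μ w q (w t / q t))) μ) :
    Integrable (fun x => g x ^ 2 * w x * ((∫ z, (1 - imhAcceptQ w q x z) * q z ∂μ)
        / (1 - ∫ z, (1 - imhAcceptQ w q x z) * q z ∂μ))) μ ∧
    ∫ t, g t ^ 2 * w t / (1 - rejCurve μ w q (w t / q t)) ∂μ
      = (∫ t, g t ^ 2 * w t ∂μ) + ∫ x, g x ^ 2 * w x * ((∫ z, (1 - imhAcceptQ w q x z) * q z ∂μ)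
          / (1 - ∫ z, (1 - imhAcceptQ w q x z) * q z ∂μ)) ∂μ := by
  obtain ⟨-, hρ⟩ := acc_facts hw0 hwm hwi hq0 hqm hqi hq1
  -- pointwise: `g² w r/(1−r) = g² w/ρ − g² w`
  have hpt : ∀ x, g x ^ 2 * w x * ((∫ z, (1 - imhAcceptQ w q x z) * q z ∂μ)
      / (1 - ∫ z, (1 - imhAcceptQ w q x z) * q z ∂μ))
      = g x ^ 2 * w x / (1 - rejCurve μ w q (w x / q x)) - g x ^ 2 * w x := by
    intro x
    rw [rejection_eq_rejCurve hw0 hq0 x]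
    have hρx : 1 - rejCurve μ w q (w x / q x) ≠ 0 := (hρ x).1.ne'
    field_simp
    ring
  have hint : Integrable (fun x => g x ^ 2 * w x * ((∫ z, (1 - imhAcceptQ w q x z) * q z ∂μ)
      / (1 - ∫ z, (1 - imhAcceptQ w q x z) * q z ∂μ))) μ :=
    (hG.sub hg2).congr (Eventually.of_forall fun x => (hpt x).symm)
  refine ⟨hint, ?_⟩
  rw [integral_congr_ae (Eventually.of_forall hpt), integral_sub hG hg2]
  ring

/-- **THE ONE-COLUMN BRACKET ON `L²(w)`.**  `w, q > 0` measurable integrable, `∫ q = 1`, `Z = ∫ w`,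
`ρ = 1 − r` the per-configuration acceptance, `ā = ∫ ρ w/Z`; `g` measurable with `∫ g² w < ∞`,
`∫ g w = 0`, `P = ∫ g² w > 0`, `G₂ = ∫ g² w/ρ < ∞`; `S = (∫ g² w r/(1 − r))/P`.  Then the normalised
autocorrelation series of `g` under `K = imhOp μ w q` is summable and
**`½ + S ≤ τ_int(g) ≤ (1 + S)/ā − ½`**. -/
theorem imhOp_tauInt_bracket_of_sq (hw0 : ∀ t, 0 < w t) (hwm : Measurable w)
    (hwi : Integrable w μ) (hq0 : ∀ t, 0 < q t) (hqm : Measurable q) (hqi : Integrable q μ)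
    (hq1 : ∫ z, q z ∂μ = 1) {g : X → ℝ} (hgm : Measurable g)
    (hg2 : Integrable (fun t => g t ^ 2 * w t) μ) (hg0 : ∫ t, g t * w t ∂μ = 0)
    (hP : 0 < ∫ t, g t ^ 2 * w t ∂μ)
    (hG : Integrable (fun t => g t ^ 2 * w t / (1 - rejCurve μ w q (w t / q t))) μ) :
    (Summable fun n => (∫ t, g t * ((imhOp μ w q)^[n + 1] g) t * w t ∂μ)
      / ∫ t, g t ^ 2 * w t ∂μ) ∧
    1 / 2 + (∫ x, g x ^ 2 * w x * ((∫ z, (1 - imhAcceptQ w q x z) * q z ∂μ)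
        / (1 - ∫ z, (1 - imhAcceptQ w q x z) * q z ∂μ)) ∂μ) / (∫ t, g t ^ 2 * w t ∂μ)
      ≤ tauInt (fun n => (∫ t, g t * ((imhOp μ w q)^[n] g) t * w t ∂μ) / ∫ t, g t ^ 2 * w t ∂μ) ∧
    tauInt (fun n => (∫ t, g t * ((imhOp μ w q)^[n] g) t * w t ∂μ) / ∫ t, g t ^ 2 * w t ∂μ)
      ≤ (1 + (∫ x, g x ^ 2 * w x * ((∫ z, (1 - imhAcceptQ w q x z) * q z ∂μ)
          / (1 - ∫ z, (1 - imhAcceptQ w q x z) * q z ∂μ)) ∂μ) / ∫ t, g t ^ 2 * w t ∂μ)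
        / ((∫ t, (1 - rejCurve μ w q (w t / q t)) * w t ∂μ) / ∫ z, w z ∂μ) - 1 / 2 := by
  obtain ⟨hs, hceil⟩ := imhOp_tauInt_le_acceptanceCeiling_of_sq hw0 hwm hwi hq0 hqm hqi hq1 hgm hg2
    hg0 hP hG
  obtain ⟨-, heq⟩ := integral_sq_mul_weight_div_acc_eq_of_sq hw0 hwm hwi hq0 hqm hqi hq1 hg2 hG
  have hfloor := imhOp_tauInt_ge_stickingSummed_of_sq hw0 hwm hwi hq0 hqm hqi hq1 hgm hg2 hs
  refine ⟨hs, hfloor, hceil.trans (le_of_eq ?_)⟩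
  set P := ∫ t, g t ^ 2 * w t ∂μ with hPdef
  set Z := ∫ z, w z ∂μ with hZdef
  set Pρ := ∫ t, (1 - rejCurve μ w q (w t / q t)) * w t ∂μ with hPρdef
  set Sint := ∫ x, g x ^ 2 * w x * ((∫ z, (1 - imhAcceptQ w q x z) * q z ∂μ)
    / (1 - ∫ z, (1 - imhAcceptQ w q x z) * q z ∂μ)) ∂μ with hSint
  have hZ : 0 < Z := integral_pos_of_pos hw0 hwi hq1
  have hPρ : 0 < Pρ := (acc_mul_weight_integral_pos hw0 hwm hwi hq0 hqm hqi hq1).2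
  rw [heq]
  field_simp

/-- **ALGEBRAIC DECORRELATION FROM THE SAME COLUMN**: under the hypotheses of the bracket, for every
lag `N`:  **`ρ_g(N) ≤ ((1 + S)/ā)/(N + 1)`** — the flow arm is a positive operator on `L²(w)`, so its
autocovariances are nonincreasing and the cap on their partial sums is a cap on each term
(`ReversibleVariationalCeilingTermwise`); no weight bound (compare the geometric
`ρ_g(N) ≤ (1 − Z/C)ᴺ` of `FlowSamplerSquareIntegrableDecay`, which needs `e^{−S} ≤ C q̃`). -/
theorem imhOp_autocorr_le_div_of_sq (hw0 : ∀ t, 0 < w t) (hwm : Measurable w)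
    (hwi : Integrable w μ) (hq0 : ∀ t, 0 < q t) (hqm : Measurable q) (hqi : Integrable q μ)
    (hq1 : ∫ z, q z ∂μ = 1) {g : X → ℝ} (hgm : Measurable g)
    (hg2 : Integrable (fun t => g t ^ 2 * w t) μ) (hg0 : ∫ t, g t * w t ∂μ = 0)
    (hP : 0 < ∫ t, g t ^ 2 * w t ∂μ)
    (hG : Integrable (fun t => g t ^ 2 * w t / (1 - rejCurve μ w q (w t / q t))) μ) (N : ℕ) :
    (∫ t, g t * ((imhOp μ w q)^[N] g) t * w t ∂μ) / (∫ t, g t ^ 2 * w t ∂μ)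
      ≤ (1 + (∫ x, g x ^ 2 * w x * ((∫ z, (1 - imhAcceptQ w q x z) * q z ∂μ)
          / (1 - ∫ z, (1 - imhAcceptQ w q x z) * q z ∂μ)) ∂μ) / ∫ t, g t ^ 2 * w t ∂μ)
        / ((∫ t, (1 - rejCurve μ w q (w t / q t)) * w t ∂μ) / ∫ z, w z ∂μ) / ((N : ℝ) + 1) := by
  have hw0' : ∀ t, 0 ≤ w t := fun t => (hw0 t).le
  obtain ⟨hB, -⟩ := acceptanceCeiling_setup_of_sq hw0 hwm hwi hq0 hqm hqi hq1 hgm hg2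
  have h := RevOp.autocorr_le_div_of_forall_sq_inner_le_dirichlet_of_pos (A := fun f : X → ℝ =>
      Measurable f ∧ Integrable (fun t => f t ^ 2 * w t) μ) (K := imhOp μ w q) hw0'
    (sqClass_int hw0 hwm) (sqClass_comb hw0 hwm) (sqClass_stab hw0 hwm hwi hq0 hqm hqi hq1)
    (sqClass_lin hw0 hwm hwi hq0 hqm hqi) (sqClass_symm hw0 hwm hwi hq0 hqm hqi hq1)
    (sqClass_contr hw0 hwm hwi hq0 hqm hqi hq1) (sqClass_pos hw0 hwm hwi hq0 hqm hqi hq1) ⟨hgm, hg2⟩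
    hP hB (fun v hv => sq_inner_le_acceptance_mul_dirichlet_of_sq hw0 hwm hwi hq0 hqm hqi hq1 hgm hg2
      hg0 hG hv.1 hv.2) N
  refine h.trans (le_of_eq ?_)
  obtain ⟨-, heq⟩ := integral_sq_mul_weight_div_acc_eq_of_sq hw0 hwm hwi hq0 hqm hqi hq1 hg2 hG
  set P := ∫ t, g t ^ 2 * w t ∂μ with hPdef
  set Z := ∫ z, w z ∂μ with hZdef
  set Pρ := ∫ t, (1 - rejCurve μ w q (w t / q t)) * w t ∂μ with hPρdef
  set Sint := ∫ x, g x ^ 2 * w x * ((∫ z, (1 - imhAcceptQ w q x z) * q z ∂μ)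
    / (1 - ∫ z, (1 - imhAcceptQ w q x z) * q z ∂μ)) ∂μ with hSint
  have hZ : 0 < Z := integral_pos_of_pos hw0 hwi hq1
  have hPρ : 0 < Pρ := (acc_mul_weight_integral_pos hw0 hwm hwi hq0 hqm hqi hq1).2
  have hN : 0 < (N : ℝ) + 1 := by positivity
  rw [heq]
  field_simp

end General

/-! ## §2 The lattice: row 2's φ⁴ flow sampler -/

section Lattice

variable {n : ℕ}

/-- **THE ONE-COLUMN BRACKET FOR EVERY POLYNOMIAL OBSERVABLE OF LATTICE φ⁴ UNDER THE FLOW ARM.**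
`f ∈ PolyObs`, `Var f > 0`, `g = f − ⟨f⟩`, `G₂ = ∫ g² e^{−S}/ρ < ∞`; `S = (∫ g² e^{−S} r/(1 − r))/∫ g² e^{−S}`,
`ā = ∫ ρ e^{−S}/Z`.  Then the series is summable and `½ + S ≤ τ_int(f) ≤ (1 + S)/ā − ½`. -/
theorem phi4Flow_tauInt_bracket_poly {lam : ℝ} (hlam : 0 < lam)
    (J : Fin (n + 1) → Fin (n + 1) → ℝ) {q : (Fin (n + 1) → ℝ) → ℝ} (hq0 : ∀ φ, 0 < q φ)
    (hqm : Measurable q) (hqi : Integrable q) (hq1 : ∫ φ, q φ = 1) {f : (Fin (n + 1) → ℝ) → ℝ}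
    (hf : PolyObs f) (hP : 0 < ∫ φ, (f φ - gibbsExpect J lam f) ^ 2 * gibbsWeight J lam φ)
    (hG : Integrable (fun φ => (f φ - gibbsExpect J lam f) ^ 2 * gibbsWeight J lam φ
      / (1 - rejCurve volume (gibbsWeight J lam) q (gibbsWeight J lam φ / q φ)))) :
    (Summable fun k => (∫ φ, (f φ - gibbsExpect J lam f)
        * ((imhOpPhi4 J lam q)^[k + 1] (fun ψ => f ψ - gibbsExpect J lam f)) φ * gibbsWeight J lam φ)
        / ∫ φ, (f φ - gibbsExpect J lam f) ^ 2 * gibbsWeight J lam φ) ∧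
    1 / 2 + (∫ φ, (f φ - gibbsExpect J lam f) ^ 2 * gibbsWeight J lam φ
        * ((∫ φ', (1 - imhAcceptQ (gibbsWeight J lam) q φ φ') * q φ')
          / (1 - ∫ φ', (1 - imhAcceptQ (gibbsWeight J lam) q φ φ') * q φ')))
        / (∫ φ, (f φ - gibbsExpect J lam f) ^ 2 * gibbsWeight J lam φ)
      ≤ tauInt (fun k => (∫ φ, (f φ - gibbsExpect J lam f)
          * ((imhOpPhi4 J lam q)^[k] (fun ψ => f ψ - gibbsExpect J lam f)) φ * gibbsWeight J lam φ)
          / ∫ φ, (f φ - gibbsExpect J lam f) ^ 2 * gibbsWeight J lam φ) ∧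
    tauInt (fun k => (∫ φ, (f φ - gibbsExpect J lam f)
          * ((imhOpPhi4 J lam q)^[k] (fun ψ => f ψ - gibbsExpect J lam f)) φ * gibbsWeight J lam φ)
          / ∫ φ, (f φ - gibbsExpect J lam f) ^ 2 * gibbsWeight J lam φ)
      ≤ (1 + (∫ φ, (f φ - gibbsExpect J lam f) ^ 2 * gibbsWeight J lam φ
          * ((∫ φ', (1 - imhAcceptQ (gibbsWeight J lam) q φ φ') * q φ')
            / (1 - ∫ φ', (1 - imhAcceptQ (gibbsWeight J lam) q φ φ') * q φ')))
          / ∫ φ, (f φ - gibbsExpect J lam f) ^ 2 * gibbsWeight J lam φ)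
        / ((∫ φ, (1 - rejCurve volume (gibbsWeight J lam) q (gibbsWeight J lam φ / q φ))
            * gibbsWeight J lam φ) / ∫ φ, gibbsWeight J lam φ) - 1 / 2 := by
  obtain ⟨hgm, hg2⟩ := polyObs_sq_integrable hlam J (polyObs_sub_const hf (gibbsExpect J lam f))
  have hg0 := integral_polyObs_sub_gibbsExpect hlam J hf
  rw [imhOpPhi4_eq_imhOp]
  exact imhOp_tauInt_bracket_of_sq (μ := volume) (fun φ => gibbsWeight_pos J lam φ)
    (continuous_gibbsWeight J lam).measurable (integrable_gibbsWeight hlam J) hq0 hqm hqi hq1 hgm hg2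
    hg0 hP hG

/-- **THE MAGNETISATION'S ONE-COLUMN BRACKET**: `M = Σ_x φ_x`, `M̃ = M − ⟨M⟩` (`Var M > 0` from the
tree), `G₂(M) < ∞` ⇒ summable series and `½ + S_M ≤ τ_int(M) ≤ (1 + S_M)/ā − ½`,
`S_M = E_{M̃²}[r/(1 − r)]/Var M`. -/
theorem phi4Flow_tauInt_bracket_magnetisation {lam : ℝ} (hlam : 0 < lam)
    (J : Fin (n + 1) → Fin (n + 1) → ℝ) {q : (Fin (n + 1) → ℝ) → ℝ} (hq0 : ∀ φ, 0 < q φ)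
    (hqm : Measurable q) (hqi : Integrable q) (hq1 : ∫ φ, q φ = 1)
    (hG : Integrable (fun φ => ((∑ x, φ x) - gibbsExpect J lam (fun ψ => ∑ x, ψ x)) ^ 2
      * gibbsWeight J lam φ
      / (1 - rejCurve volume (gibbsWeight J lam) q (gibbsWeight J lam φ / q φ)))) :
    (Summable fun k => (∫ φ, ((∑ x, φ x) - gibbsExpect J lam (fun ψ => ∑ x, ψ x))
        * ((imhOpPhi4 J lam q)^[k + 1]
            (fun ψ => (∑ x, ψ x) - gibbsExpect J lam (fun ψ => ∑ x, ψ x))) φ * gibbsWeight J lam φ)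
        / ∫ φ, ((∑ x, φ x) - gibbsExpect J lam (fun ψ => ∑ x, ψ x)) ^ 2 * gibbsWeight J lam φ) ∧
    1 / 2 + (∫ φ, ((∑ x, φ x) - gibbsExpect J lam (fun ψ => ∑ x, ψ x)) ^ 2 * gibbsWeight J lam φ
        * ((∫ φ', (1 - imhAcceptQ (gibbsWeight J lam) q φ φ') * q φ')
          / (1 - ∫ φ', (1 - imhAcceptQ (gibbsWeight J lam) q φ φ') * q φ')))
        / (∫ φ, ((∑ x, φ x) - gibbsExpect J lam (fun ψ => ∑ x, ψ x)) ^ 2 * gibbsWeight J lam φ)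
      ≤ tauInt (fun k => (∫ φ, ((∑ x, φ x) - gibbsExpect J lam (fun ψ => ∑ x, ψ x))
          * ((imhOpPhi4 J lam q)^[k]
              (fun ψ => (∑ x, ψ x) - gibbsExpect J lam (fun ψ => ∑ x, ψ x))) φ * gibbsWeight J lam φ)
          / ∫ φ, ((∑ x, φ x) - gibbsExpect J lam (fun ψ => ∑ x, ψ x)) ^ 2 * gibbsWeight J lam φ) ∧
    tauInt (fun k => (∫ φ, ((∑ x, φ x) - gibbsExpect J lam (fun ψ => ∑ x, ψ x))
          * ((imhOpPhi4 J lam q)^[k]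
              (fun ψ => (∑ x, ψ x) - gibbsExpect J lam (fun ψ => ∑ x, ψ x))) φ * gibbsWeight J lam φ)
          / ∫ φ, ((∑ x, φ x) - gibbsExpect J lam (fun ψ => ∑ x, ψ x)) ^ 2 * gibbsWeight J lam φ)
      ≤ (1 + (∫ φ, ((∑ x, φ x) - gibbsExpect J lam (fun ψ => ∑ x, ψ x)) ^ 2 * gibbsWeight J lam φ
          * ((∫ φ', (1 - imhAcceptQ (gibbsWeight J lam) q φ φ') * q φ')
            / (1 - ∫ φ', (1 - imhAcceptQ (gibbsWeight J lam) q φ φ') * q φ')))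
          / ∫ φ, ((∑ x, φ x) - gibbsExpect J lam (fun ψ => ∑ x, ψ x)) ^ 2 * gibbsWeight J lam φ)
        / ((∫ φ, (1 - rejCurve volume (gibbsWeight J lam) q (gibbsWeight J lam φ / q φ))
            * gibbsWeight J lam φ) / ∫ φ, gibbsWeight J lam φ) - 1 / 2 :=
  phi4Flow_tauInt_bracket_poly hlam J hq0 hqm hqi hq1 polyObs_magnetisation
    (integral_magnetisation_sub_sq_mul_gibbsWeight_pos hlam J _) hG

/-- **THE MAGNETISATION'S BRACKET WITH `G₂(M) < ∞` DISCHARGED FROM A GAUSSIAN MINORANT** of the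
model density (`q̃ ≥ c e^{−κΣ_w φ_w²}`, `c > 0`; affine-coupling flows with bounded log-scales):
summable series and `½ + S_M ≤ τ_int(M) ≤ (1 + S_M)/ā − ½`, both columns finite. -/
theorem phi4Flow_tauInt_bracket_magnetisation_of_gaussian_minorant {lam : ℝ} (hlam : 0 < lam)
    (J : Fin (n + 1) → Fin (n + 1) → ℝ) {q : (Fin (n + 1) → ℝ) → ℝ} (hq0 : ∀ φ, 0 < q φ)
    (hqm : Measurable q) (hqi : Integrable q) (hq1 : ∫ φ, q φ = 1) {c κ : ℝ} (hc : 0 < c)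
    (hqc : ∀ φ, c * Real.exp (-(κ * ∑ w, φ w ^ 2)) ≤ q φ) :
    (Summable fun k => (∫ φ, ((∑ x, φ x) - gibbsExpect J lam (fun ψ => ∑ x, ψ x))
        * ((imhOpPhi4 J lam q)^[k + 1]
            (fun ψ => (∑ x, ψ x) - gibbsExpect J lam (fun ψ => ∑ x, ψ x))) φ * gibbsWeight J lam φ)
        / ∫ φ, ((∑ x, φ x) - gibbsExpect J lam (fun ψ => ∑ x, ψ x)) ^ 2 * gibbsWeight J lam φ) ∧
    1 / 2 + (∫ φ, ((∑ x, φ x) - gibbsExpect J lam (fun ψ => ∑ x, ψ x)) ^ 2 * gibbsWeight J lam φ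
        * ((∫ φ', (1 - imhAcceptQ (gibbsWeight J lam) q φ φ') * q φ')
          / (1 - ∫ φ', (1 - imhAcceptQ (gibbsWeight J lam) q φ φ') * q φ')))
        / (∫ φ, ((∑ x, φ x) - gibbsExpect J lam (fun ψ => ∑ x, ψ x)) ^ 2 * gibbsWeight J lam φ)
      ≤ tauInt (fun k => (∫ φ, ((∑ x, φ x) - gibbsExpect J lam (fun ψ => ∑ x, ψ x))
          * ((imhOpPhi4 J lam q)^[k]
              (fun ψ => (∑ x, ψ x) - gibbsExpect J lam (fun ψ => ∑ x, ψ x))) φ * gibbsWeight J lam φ)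
          / ∫ φ, ((∑ x, φ x) - gibbsExpect J lam (fun ψ => ∑ x, ψ x)) ^ 2 * gibbsWeight J lam φ) ∧
    tauInt (fun k => (∫ φ, ((∑ x, φ x) - gibbsExpect J lam (fun ψ => ∑ x, ψ x))
          * ((imhOpPhi4 J lam q)^[k]
              (fun ψ => (∑ x, ψ x) - gibbsExpect J lam (fun ψ => ∑ x, ψ x))) φ * gibbsWeight J lam φ)
          / ∫ φ, ((∑ x, φ x) - gibbsExpect J lam (fun ψ => ∑ x, ψ x)) ^ 2 * gibbsWeight J lam φ)
      ≤ (1 + (∫ φ, ((∑ x, φ x) - gibbsExpect J lam (fun ψ => ∑ x, ψ x)) ^ 2 * gibbsWeight J lam φ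
          * ((∫ φ', (1 - imhAcceptQ (gibbsWeight J lam) q φ φ') * q φ')
            / (1 - ∫ φ', (1 - imhAcceptQ (gibbsWeight J lam) q φ φ') * q φ')))
          / ∫ φ, ((∑ x, φ x) - gibbsExpect J lam (fun ψ => ∑ x, ψ x)) ^ 2 * gibbsWeight J lam φ)
        / ((∫ φ, (1 - rejCurve volume (gibbsWeight J lam) q (gibbsWeight J lam φ / q φ))
            * gibbsWeight J lam φ) / ∫ φ, gibbsWeight J lam φ) - 1 / 2 :=
  phi4Flow_tauInt_bracket_magnetisation hlam J hq0 hqm hqi hq1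
    (phi4Flow_tauInt_le_acceptanceCeiling_magnetisation_of_gaussian_minorant hlam J hq0 hqm hqi hq1
      hc hqc).1

/-- **ALGEBRAIC DECORRELATION OF THE MAGNETISATION FROM THE MEASURED COLUMN**: `G₂(M) < ∞` ⇒ for
every lag `N`, `ρ_M(N) ≤ ((1 + S_M)/ā)/(N + 1)` — every positive model density, no weight bound. -/
theorem phi4Flow_autocorr_le_div_magnetisation {lam : ℝ} (hlam : 0 < lam)
    (J : Fin (n + 1) → Fin (n + 1) → ℝ) {q : (Fin (n + 1) → ℝ) → ℝ} (hq0 : ∀ φ, 0 < q φ)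
    (hqm : Measurable q) (hqi : Integrable q) (hq1 : ∫ φ, q φ = 1)
    (hG : Integrable (fun φ => ((∑ x, φ x) - gibbsExpect J lam (fun ψ => ∑ x, ψ x)) ^ 2
      * gibbsWeight J lam φ
      / (1 - rejCurve volume (gibbsWeight J lam) q (gibbsWeight J lam φ / q φ)))) (N : ℕ) :
    (∫ φ, ((∑ x, φ x) - gibbsExpect J lam (fun ψ => ∑ x, ψ x))
        * ((imhOpPhi4 J lam q)^[N]
            (fun ψ => (∑ x, ψ x) - gibbsExpect J lam (fun ψ => ∑ x, ψ x))) φ * gibbsWeight J lam φ)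
        / ∫ φ, ((∑ x, φ x) - gibbsExpect J lam (fun ψ => ∑ x, ψ x)) ^ 2 * gibbsWeight J lam φ
      ≤ (1 + (∫ φ, ((∑ x, φ x) - gibbsExpect J lam (fun ψ => ∑ x, ψ x)) ^ 2 * gibbsWeight J lam φ
          * ((∫ φ', (1 - imhAcceptQ (gibbsWeight J lam) q φ φ') * q φ')
            / (1 - ∫ φ', (1 - imhAcceptQ (gibbsWeight J lam) q φ φ') * q φ')))
          / ∫ φ, ((∑ x, φ x) - gibbsExpect J lam (fun ψ => ∑ x, ψ x)) ^ 2 * gibbsWeight J lam φ)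
        / ((∫ φ, (1 - rejCurve volume (gibbsWeight J lam) q (gibbsWeight J lam φ / q φ))
            * gibbsWeight J lam φ) / ∫ φ, gibbsWeight J lam φ) / ((N : ℝ) + 1) := by
  obtain ⟨hgm, hg2⟩ := polyObs_sq_integrable hlam J
    (polyObs_sub_const polyObs_magnetisation (gibbsExpect J lam (fun ψ => ∑ x, ψ x)))
  have hg0 := integral_polyObs_sub_gibbsExpect hlam J (polyObs_magnetisation (n := n))
  rw [imhOpPhi4_eq_imhOp]
  exact imhOp_autocorr_le_div_of_sq (μ := volume) (fun φ => gibbsWeight_pos J lam φ)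
    (continuous_gibbsWeight J lam).measurable (integrable_gibbsWeight hlam J) hq0 hqm hqi hq1 hgm hg2
    hg0 (integral_magnetisation_sub_sq_mul_gibbsWeight_pos hlam J _) hG N

/-- **A `Z₂`-SYMMETRIC FLOW WITH A GAUSSIAN MINORANT: THE LOWER END OF THE BRACKET IS ATTAINED, WITH A
FINITE COLUMN.**  `q̃(−φ) = q̃(φ)` and `q̃ ≥ c e^{−κΣφ²}` (`c > 0`) ⇒ the autocorrelation series of `M` is
summable and `τ_int(M) = ½ + S_M` EXACTLY (`Phi4FlowSymmetricMagnetisationExact`), the column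
`S_M = E_{M̃²}[r/(1 − r)]/Var M` being finite (`G₂(M) < ∞` from the minorant, `G₂ = P(1 + S)`). -/
theorem phi4Flow_tauInt_magnetisation_eq_of_gaussian_minorant {lam : ℝ} (hlam : 0 < lam)
    (J : Fin (n + 1) → Fin (n + 1) → ℝ) {q : (Fin (n + 1) → ℝ) → ℝ} (hq0 : ∀ φ, 0 < q φ)
    (hqm : Measurable q) (hqi : Integrable q) (hq1 : ∫ φ, q φ = 1) (hqsym : ∀ φ, q (-φ) = q φ)
    {c κ : ℝ} (hc : 0 < c) (hqc : ∀ φ, c * Real.exp (-(κ * ∑ w, φ w ^ 2)) ≤ q φ) :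
    Integrable (fun φ : Fin (n + 1) → ℝ =>
      ((∑ x, φ x) - gibbsExpect J lam (fun ψ => ∑ x, ψ x)) ^ 2 * gibbsWeight J lam φ
        * ((∫ φ', (1 - imhAcceptQ (gibbsWeight J lam) q φ φ') * q φ')
          / (1 - ∫ φ', (1 - imhAcceptQ (gibbsWeight J lam) q φ φ') * q φ'))) ∧
    (Summable fun k => (∫ φ, ((∑ x, φ x) - gibbsExpect J lam (fun ψ => ∑ x, ψ x))
        * ((imhOpPhi4 J lam q)^[k + 1]
            (fun ψ => (∑ x, ψ x) - gibbsExpect J lam (fun ψ => ∑ x, ψ x))) φ * gibbsWeight J lam φ)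
        / ∫ φ, ((∑ x, φ x) - gibbsExpect J lam (fun ψ => ∑ x, ψ x)) ^ 2 * gibbsWeight J lam φ) ∧
    tauInt (fun k => (∫ φ, ((∑ x, φ x) - gibbsExpect J lam (fun ψ => ∑ x, ψ x))
        * ((imhOpPhi4 J lam q)^[k]
            (fun ψ => (∑ x, ψ x) - gibbsExpect J lam (fun ψ => ∑ x, ψ x))) φ * gibbsWeight J lam φ)
        / ∫ φ, ((∑ x, φ x) - gibbsExpect J lam (fun ψ => ∑ x, ψ x)) ^ 2 * gibbsWeight J lam φ)
      = 1 / 2 + (∫ φ, ((∑ x, φ x) - gibbsExpect J lam (fun ψ => ∑ x, ψ x)) ^ 2 * gibbsWeight J lam φ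
          * ((∫ φ', (1 - imhAcceptQ (gibbsWeight J lam) q φ φ') * q φ')
            / (1 - ∫ φ', (1 - imhAcceptQ (gibbsWeight J lam) q φ φ') * q φ')))
        / ∫ φ, ((∑ x, φ x) - gibbsExpect J lam (fun ψ => ∑ x, ψ x)) ^ 2 * gibbsWeight J lam φ := by
  have hG := (phi4Flow_tauInt_le_acceptanceCeiling_magnetisation_of_gaussian_minorant hlam J hq0 hqm
    hqi hq1 hc hqc).1
  obtain ⟨-, hg2⟩ := polyObs_sq_integrable hlam J
    (polyObs_sub_const polyObs_magnetisation (gibbsExpect J lam (fun ψ => ∑ x, ψ x)))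
  have hS := (integral_sq_mul_weight_div_acc_eq_of_sq (μ := volume) (fun φ => gibbsWeight_pos J lam φ)
    (continuous_gibbsWeight J lam).measurable (integrable_gibbsWeight hlam J) hq0 hqm hqi hq1 hg2 hG).1
  exact ⟨hS, phi4Flow_tauInt_magnetisation_eq hlam J hq0 hqm hqi hq1 hqsym hS⟩

end Lattice

end Summit.Ventures.LatticeQCDFlow.Exactness
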